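import Literature.NumberTheory.Rogawski1990.ArchChartOrbGIsolateFinset   -- ★ (J-iso)^T (F0P3a-p05 (g21)): `chartOrbG_eq_prod_mul_integral_pi_group_isolate_of_forall_not_mem`; brings ★ (J-iso), ★ (A1)
import HarnessLib

/-!
# `chartOrbG` of a TENSOR over a place partition `W = D ⊔ I`: for `f = b(g_D) · u` with `u` conjugation-invariant in the `D`-coordinates, the global chart-orbital
# family FACTORS as (whole-group orbital integral of `b` over `Π_{w∈D} U(α)_w`) × (the `I`-side chart-orbital reading of `u(γ_D(c), ·)`)
# («PER-PLACE FUBINI» on ★ (J-iso)^T; Folland 1995 §2.2, §2.6 (2.52); Rogawski 1990 §8.2–8.3; Borel–Jacquet 1979 §4.1)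

Topic `NumberTheory/Rogawski1990`; namespace `Literature.NumberTheory.Automorphic.UnitaryGroup`.  THEOREMS ONLY (no `def`, no instance, no notation, no axiom, no named fact,
no `sorry`).  Cell `pub/hodgecm-mathlib`, crux H413 (`stmt-HodgeConjecture-24833`), F0∕P3c line LH2 «N8-INNER», ROAD B «EULER–POINCARÉ ROAD» (dealer LH2-plan (g1), brick (F)
«PER-PLACE FUBINI ON `arch`», deal 2026-09-02T16:03:28Z, «TYPE (F)» 16:17:17Z; census `F0/P2/p02/g21/n8F/CENSUS-N8-F-perplaceFubini.v1.F0P2p02g21.md`), seat F0P2-p02 (g21).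
Count-neutral measure-theoretic bookkeeping: nothing here closes an organ.

THE MATHEMATICS.  ★ (J-iso)^T `chartOrbG_eq_prod_mul_integral_pi_group_isolate_of_forall_not_mem` writes, for an admissible label `S′`, a decidable predicate `p` selecting
COMPACT-chart places (`hp : p w → w ∉ S′`; ROAD B: `p := (· ∈ D)`, `D` the `α`-definite places), a regular `c ∈ RegG S′` and `a′ ∈ C_c(G′_∞)`:
`chartOrbG ν′ S′ a′ c = (Π_{¬p} t_w(B′_w)) · ∫_{g ∈ Π_{p} U(α)_w} Θ_c((g_w γ_w(c) g_w⁻¹)_{p}) d(⊗_{p} ν′_w)`, `Θ_c(x) = ∫_{Π_{¬p}(U_w ⧸ T′_w)} a′(e⁻¹(x, (ḃ_w γ_w(c) ḃ_w⁻¹)_{¬p})) d(⊗_{¬p} ν′_w∕t_w)`.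
If the test function is a TENSOR over the partition in the product coordinates, `a′(e⁻¹(x, y)) = b(x) · u(e⁻¹(x, y))` (hypothesis `hf`), with `u` INVARIANT under conjugation of
the `p`-coordinates at the orbit, `u(e⁻¹((g_w γ_w g_w⁻¹)_w, y)) = u(e⁻¹((γ_w)_w, y))` (hypothesis `hu`; e.g. `u` a class function in the `D`-variables, or constant in them), then
`Θ_c((gγg⁻¹)_{p}) = b((gγg⁻¹)_{p}) · U_c` with `U_c := ∫_{Π_{¬p}(U_w ⧸ T′_w)} u(e⁻¹((γ_w)_{p}, (ḃ_w γ_w ḃ_w⁻¹)_{¬p})) d(⊗_{¬p} ν′_w∕t_w)` INDEPENDENT of `g`, so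
  **`chartOrbG ν′ S′ a′ c = (Π_{¬p} t_w(B′_w)) · (∫_{Π_{p} U(α)_w} b((g_w γ_w(c) g_w⁻¹)_{p}) d(⊗_{p} ν′_w)) · U_c`**
(`chartOrbG_eq_prod_mul_integral_pi_mul_integral_of_tensor`): the `D`-side is ONE WHOLE-GROUP ORBITAL INTEGRAL of `b` over `Π_{w∈D} U(α)_w` at `γ_D(c)`, the `I`-side is the
chart-orbital reading of `u(γ_D(c), ·)` at `c|_I` (with its box constants) — the regions of ROAD B are tensors of one-place generators read by this identity.  Pulling the
`g`-independent factor out of a Bochner integral needs NO integrability (`integral_const_mul`, `integral_mul_const`), so the head carries no `Integrable` binder beyond ★'s `C_c`.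
HONEST LABEL: HC_CM is proved only modulo the 7 printed citations (2 remaining: hLiu418 = `stmt-HodgeConjecture-24832`, h413 = `stmt-HodgeConjecture-24833`) until rung 0 closes;
this file moves no row of the books.

## References
* [Folland1995] G. B. Folland, *A Course in Abstract Harmonic Analysis* (1995), §2.2 (product measures), §2.6 Thm. 2.49, (2.52) (quotient integral formula).
* [Rogawski1990] J. D. Rogawski, *Automorphic Representations of Unitary Groups in Three Variables*, Ann. of Math. Stud. 123 (1990), §8.2 p. 122, §8.3 p. 124.
* [BorelJacquet1979] A. Borel, H. Jacquet, *Automorphic forms and automorphic representations*, PSPM 33.1 (1979), §4.1 (`G_∞ = Π_v G(F_v)`, product test functions).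
-/

set_option autoImplicit false

noncomputable section

open MeasureTheory MeasureTheory.Measure NumberField NumberField.InfinitePlace Matrix Complex Topology
open Literature.MeasureTheory.Group Literature.NumberTheory.Rogawski1990
open scoped MatrixGroups Matrix Classical ENNReal NNReal

namespace Literature.NumberTheory.Automorphic.UnitaryGroup

section Tensor

variable (L : Type) [Field L] [NumberField L] [IsCMField L] (α : Fin 3 → L) (S' : Finset {w : InfinitePlace L // IsComplex w})
  [∀ w : {w : InfinitePlace L // IsComplex w}, MeasurableSpace ↥(archLocal L 3 (Matrix.diagonal α) w)]
  [∀ w : {w : InfinitePlace L // IsComplex w}, BorelSpace ↥(archLocal L 3 (Matrix.diagonal α) w)]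
  [∀ w : {w : InfinitePlace L // IsComplex w}, LocallyCompactSpace ↥(archLocal L 3 (Matrix.diagonal α) w)]
  [∀ w : {w : InfinitePlace L // IsComplex w}, SecondCountableTopology ↥(archLocal L 3 (Matrix.diagonal α) w)]
  [MeasurableSpace ↥(arch (↥(maximalRealSubfield L)) L (IsCMField.complexConj L) 3 (Matrix.diagonal α))]
  [BorelSpace ↥(arch (↥(maximalRealSubfield L)) L (IsCMField.complexConj L) 3 (Matrix.diagonal α))]
  [∀ w : {w : InfinitePlace L // IsComplex w}, MeasurableSpace (↥(archLocal L 3 (Matrix.diagonal α) w) ⧸ chartTorusGLoc L α w S')]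
  [∀ w : {w : InfinitePlace L // IsComplex w}, BorelSpace (↥(archLocal L 3 (Matrix.diagonal α) w) ⧸ chartTorusGLoc L α w S')]
  (ν'w : ∀ w : {w : InfinitePlace L // IsComplex w}, Measure ↥(archLocal L 3 (Matrix.diagonal α) w)) [∀ w, (ν'w w).IsHaarMeasure] [∀ w, (ν'w w).IsMulRightInvariant]
  (ν' : Measure ↥(arch (↥(maximalRealSubfield L)) L (IsCMField.complexConj L) 3 (Matrix.diagonal α))) [ν'.IsHaarMeasure] [ν'.IsMulRightInvariant]
  (hν : ν' = (Measure.pi ν'w).map (archPiEquivCM 3 L (Matrix.diagonal α)).symm)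
  (t : ∀ w : {w : InfinitePlace L // IsComplex w}, Measure ↥(chartTorusGLoc L α w S')) [∀ w, (t w).IsHaarMeasure] [∀ w, (t w).IsInvInvariant]
  (p : {w : InfinitePlace L // IsComplex w} → Prop) [DecidablePred p]
  [Fintype {w : {w : InfinitePlace L // IsComplex w} // p w}] [Fintype {w : {w : InfinitePlace L // IsComplex w} // ¬ p w}]

include hν in
/-- **PER-PLACE FUBINI FOR A TENSOR `f = b(g_D) · u` (ROAD B's reading of a region).**  Binders of ★ (J-iso)^T §2 (`hp : p w → w ∉ S′`, `c ∈ RegG S′`, `a′ ∈ C_c`) plus the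
TENSOR hypothesis `hf` in the product coordinates `e⁻¹ ∘ (piEquivPiSubtypeProd … p)⁻¹` and the INVARIANCE `hu` of `u` under conjugation of the `p`-coordinates at the orbit
`γ_w(c) = gprimeBlockAt α w S′ (c w)`.  Then
`chartOrbG ν′ S′ a′ c = (Π_{w′:¬p} t_{w′}(B′_{w′})) · (∫_{g ∈ Π_{p} U(α)_w} b((g_w γ_w(c) g_w⁻¹)_w) d(⊗_{p} ν′_w)) · ∫_{Π_{¬p}(U_{w′} ⧸ T′_{w′})} u(e⁻¹((γ_w(c))_{p}, (ḃ γ ḃ⁻¹)_{¬p})) d(⊗_{¬p} ν′_{w′}∕t_{w′})`.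
[cite: Folland1995, §2.2; §2.6 (2.52)] [cite: Rogawski1990, §8.2 p. 122; §8.3 p. 124] [cite: BorelJacquet1979, §4.1] -/
theorem chartOrbG_eq_prod_mul_integral_pi_mul_integral_of_tensor (hα : ∀ i, α i ≠ 0) (hS' : ∀ w, w ∈ S' → w ∈ splitChartPlaces L α)
    (hp : ∀ w, p w → w ∉ S')
    {c : {w : InfinitePlace L // IsComplex w} → Fin 3 → ℝ} (hc : c ∈ ArchCartan.RegG S')
    {a' : ↥(arch (↥(maximalRealSubfield L)) L (IsCMField.complexConj L) 3 (Matrix.diagonal α)) → ℂ} (ha'c : Continuous a') (ha's : HasCompactSupport a')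
    (b : (∀ w : {w : {w : InfinitePlace L // IsComplex w} // p w}, ↥(archLocal L 3 (Matrix.diagonal α) w.1)) → ℂ)
    (u : ↥(arch (↥(maximalRealSubfield L)) L (IsCMField.complexConj L) 3 (Matrix.diagonal α)) → ℂ)
    (hf : ∀ (x : ∀ w : {w : {w : InfinitePlace L // IsComplex w} // p w}, ↥(archLocal L 3 (Matrix.diagonal α) w.1))
      (y : ∀ w' : {w : {w : InfinitePlace L // IsComplex w} // ¬ p w}, ↥(archLocal L 3 (Matrix.diagonal α) w'.1)),
      a' ((archPiEquivCM 3 L (Matrix.diagonal α)).symm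
        ((MeasurableEquiv.piEquivPiSubtypeProd (fun w : {w : InfinitePlace L // IsComplex w} => ↥(archLocal L 3 (Matrix.diagonal α) w)) p).symm (x, y))) =
      b x * u ((archPiEquivCM 3 L (Matrix.diagonal α)).symm
        ((MeasurableEquiv.piEquivPiSubtypeProd (fun w : {w : InfinitePlace L // IsComplex w} => ↥(archLocal L 3 (Matrix.diagonal α) w)) p).symm (x, y))))
    (hu : ∀ (g : ∀ w : {w : {w : InfinitePlace L // IsComplex w} // p w}, ↥(archLocal L 3 (Matrix.diagonal α) w.1))
      (y : ∀ w' : {w : {w : InfinitePlace L // IsComplex w} // ¬ p w}, ↥(archLocal L 3 (Matrix.diagonal α) w'.1)),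
      u ((archPiEquivCM 3 L (Matrix.diagonal α)).symm
        ((MeasurableEquiv.piEquivPiSubtypeProd (fun w : {w : InfinitePlace L // IsComplex w} => ↥(archLocal L 3 (Matrix.diagonal α) w)) p).symm
          (fun w => g w * gprimeBlockAt L α w.1 S' (c w.1) * (g w)⁻¹, y))) =
      u ((archPiEquivCM 3 L (Matrix.diagonal α)).symm
        ((MeasurableEquiv.piEquivPiSubtypeProd (fun w : {w : InfinitePlace L // IsComplex w} => ↥(archLocal L 3 (Matrix.diagonal α) w)) p).symm
          (fun w => gprimeBlockAt L α w.1 S' (c w.1), y)))) :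
    chartOrbG L α ν' S' a' c =
      (∏ w' : {w : {w : InfinitePlace L // IsComplex w} // ¬ p w}, ((t w'.1 (chartBoxImgGLoc L α w'.1 S')).toReal : ℂ)) *
        (∫ g : (∀ w : {w : {w : InfinitePlace L // IsComplex w} // p w}, ↥(archLocal L 3 (Matrix.diagonal α) w.1)),
            b (fun w => g w * gprimeBlockAt L α w.1 S' (c w.1) * (g w)⁻¹) ∂(Measure.pi fun w : {w : {w : InfinitePlace L // IsComplex w} // p w} => ν'w w.1)) *
        ∫ b' : (∀ w' : {w : {w : InfinitePlace L // IsComplex w} // ¬ p w}, ↥(archLocal L 3 (Matrix.diagonal α) w'.1) ⧸ chartTorusGLoc L α w'.1 S'),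
          u ((archPiEquivCM 3 L (Matrix.diagonal α)).symm
            ((MeasurableEquiv.piEquivPiSubtypeProd (fun w : {w : InfinitePlace L // IsComplex w} => ↥(archLocal L 3 (Matrix.diagonal α) w)) p).symm
              (fun w => gprimeBlockAt L α w.1 S' (c w.1),
                fun w' => descConj (gprimeBlockAt L α w'.1 S' (c w'.1)) (chartTorusGLoc L α w'.1 S') (forall_mem_chartTorusGLoc_comm L α w'.1 S' (c w'.1)) id (b' w'))))
          ∂(Measure.pi fun w' : {w : {w : InfinitePlace L // IsComplex w} // ¬ p w} =>
              quotientMeasure (chartTorusGLoc L α w'.1 S') (t w'.1) (isClosed_chartTorusGLoc L α w'.1 S') (ν'w w'.1)) := by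
  rw [chartOrbG_eq_prod_mul_integral_pi_group_isolate_of_forall_not_mem L α S' ν'w ν' hν t p hα hS' hp hc ha'c ha's, mul_assoc]
  congr 1
  -- the inner integrand is `b(gγg⁻¹) · u(γ, ·)` by the tensor shape and the `D`-conjugation invariance of `u`
  have hinner : ∀ g : (∀ w : {w : {w : InfinitePlace L // IsComplex w} // p w}, ↥(archLocal L 3 (Matrix.diagonal α) w.1)),
      (∫ b' : (∀ w' : {w : {w : InfinitePlace L // IsComplex w} // ¬ p w}, ↥(archLocal L 3 (Matrix.diagonal α) w'.1) ⧸ chartTorusGLoc L α w'.1 S'),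
          a' ((archPiEquivCM 3 L (Matrix.diagonal α)).symm
            ((MeasurableEquiv.piEquivPiSubtypeProd (fun w : {w : InfinitePlace L // IsComplex w} => ↥(archLocal L 3 (Matrix.diagonal α) w)) p).symm
              (fun w => g w * gprimeBlockAt L α w.1 S' (c w.1) * (g w)⁻¹,
                fun w' => descConj (gprimeBlockAt L α w'.1 S' (c w'.1)) (chartTorusGLoc L α w'.1 S') (forall_mem_chartTorusGLoc_comm L α w'.1 S' (c w'.1)) id (b' w'))))
          ∂(Measure.pi fun w' : {w : {w : InfinitePlace L // IsComplex w} // ¬ p w} =>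
              quotientMeasure (chartTorusGLoc L α w'.1 S') (t w'.1) (isClosed_chartTorusGLoc L α w'.1 S') (ν'w w'.1))) =
        b (fun w => g w * gprimeBlockAt L α w.1 S' (c w.1) * (g w)⁻¹) *
          ∫ b' : (∀ w' : {w : {w : InfinitePlace L // IsComplex w} // ¬ p w}, ↥(archLocal L 3 (Matrix.diagonal α) w'.1) ⧸ chartTorusGLoc L α w'.1 S'),
            u ((archPiEquivCM 3 L (Matrix.diagonal α)).symm
              ((MeasurableEquiv.piEquivPiSubtypeProd (fun w : {w : InfinitePlace L // IsComplex w} => ↥(archLocal L 3 (Matrix.diagonal α) w)) p).symm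
                (fun w => gprimeBlockAt L α w.1 S' (c w.1),
                  fun w' => descConj (gprimeBlockAt L α w'.1 S' (c w'.1)) (chartTorusGLoc L α w'.1 S') (forall_mem_chartTorusGLoc_comm L α w'.1 S' (c w'.1)) id (b' w'))))
            ∂(Measure.pi fun w' : {w : {w : InfinitePlace L // IsComplex w} // ¬ p w} =>
                quotientMeasure (chartTorusGLoc L α w'.1 S') (t w'.1) (isClosed_chartTorusGLoc L α w'.1 S') (ν'w w'.1)) := by
    intro g
    rw [← integral_const_mul]
    refine integral_congr_ae (Filter.Eventually.of_forall fun b' => ?_)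
    simp only []
    rw [hf, hu]
  simp_rw [hinner]
  rw [integral_mul_const]

end Tensor

end Literature.NumberTheory.Automorphic.UnitaryGroup

end
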